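import Literature.AnabelianGeometry.EtaleTheta.SettingModelCyclotomicCharacterLevelNontrivial
import Literature.NumberTheory.GaloisRepresentations.CyclotomicCharacterSurjectiveProofs
import HarnessLib

/-!
# `Gal(ℚ_p(ζ_{pᵏ})/ℚ_p) = (ℤ/pᵏℤ)^×`: `Φ_{pᵏ}` is irreducible over `ℚ_p`, and the mod-`pᵏ` cyclotomic character
# of `G_{ℚ_p}` takes EVERY unit value (classical; proof-only)

J.-P. Serre, *Local Fields*, IV §4 Prop. 17: `ℚ_p(ζ_{pᵏ})/ℚ_p` is totally ramified of degree `φ(pᵏ)` with Galois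
group `(ℤ/pᵏℤ)^×` [cite: SerreLocalFields1979, IV §4 Prop 17]; L. C. Washington, *Introduction to Cyclotomic Fields*,
Thm. 2.5 and its proof (`Gal(K(μ_N)/K) ↪ (ℤ/N)^×`, onto when `Φ_N` is irreducible over `K`) [cite: Washington1997, Thm 2.5];
S. Mochizuki, [EtTh] §1 p. 13 ("`K_N := K(ζ_N, q_X^{1/N})`", the `G_K`-action on `μ_N`) [cite: MochizukiEtTh2009, §1 p.13].

abc-iut cell, layer L2, seat abc-iut-w5-d091 (gen 5); χ-lineage (R78 F3), F3 addendum 4.  PROOF-ONLY (no definition,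
no instance, no named fact).  abc-iut-w5-d125 proved the cases `k = 1` (odd `p`) and `k = 2` of the irreducibility
(`RootsOfUnityGaloisNontrivial(OddPrime)`: Eisenstein at `p` for `Φ_{pᵏ}(X+1)`, Mathlib's
`cyclotomic_prime_pow_comp_X_add_one_isEisensteinAt`, transported to `ℤ_p`, then Gauss's lemma); this file runs the
same argument for EVERY `k ≥ 1` and draws the Galois consequence with the tree's
`RootOfUnityAction.exists_smul_eq_pow_and_smul_eq_self` (`IsCyclotomicExtension.autEquivPow` + `AlgEquiv.liftNormal`):

* `cyclotomic_prime_pow_comp_X_add_one_isEisensteinAt_padicInt` — `Φ_{p^{n+1}}(X+1) ∈ ℤ_p[X]` is Eisenstein at `(p)`;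
* **`irreducible_cyclotomic_prime_pow_padic (hk : 0 < k) : Irreducible (cyclotomic (p ^ k) ℚ_[p])`** (via the
  translate `X ↦ X + 1`, `Polynomial.algEquivAevalXAddC`), i.e. `[ℚ_p(ζ_{pᵏ}) : ℚ_p] = φ(pᵏ)`;
* **`exists_algEquiv_apply_eq_pow_of_prime_pow (hk : 0 < k) (a : (ZMod (p ^ k))ˣ)`** — some `σ ∈ G_{ℚ_p}` acts on ALL
  `pᵏ`-th roots of unity of `ℚ̄_p` by `ζ ↦ ζ ^ a`; `galMuN` form `exists_galMuN_eq_pow_of_prime_pow`;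
* the χ-form for THE cyclotomic character `χ` of F3 (`SettingModelCyclotomicCharacter`):
  **`SettingModel.exists_levelChar_chi_eq (hk : 0 < k) (a : (ZMod (p ^ k))ˣ) : ∃ σ, χ_{pᵏ}(σ) = a`** and
  `SettingModel.range_levelChar_chi_prime_pow` — the IMAGE of `χ_{pᵏ} = levelChar (pᵏ) ∘ χ : G_{ℚ_p} → ℤ/pᵏℤ` is EXACTLY
  the unit group `(ℤ/pᵏℤ)^×`, `surjective_levelChar_chi_units` (the sharp form of F3 addendum 3's non-triviality
  `exists_levelChar_chi_ne_one_of_sq_dvd` / `_of_dvd`).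
Classical; nothing of [EtTh] is asserted; no side is taken on [IUTchIII] Cor. 3.12; a model is consistency evidence only.
-/

noncomputable section

open CategoryTheory ProfiniteGrp ProfiniteGrp.ProfiniteCompletion

namespace Literature.AnabelianGeometry.EtaleTheta

open Polynomial Literature.AnabelianGeometry.SemiGraphs

variable (p : ℕ) [hp : Fact p.Prime]

/-! ### `Φ_{p^{n+1}}(X+1)` is Eisenstein over `ℤ_p`; `Φ_{pᵏ}` is irreducible over `ℚ_p` -/

omit hp in
/-- `Φ_{p^{n+1}}(X + 1) ∈ ℤ[X]` is monic. [folklore] -/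
private theorem monic_cyclotomic_prime_pow_comp_X_add_one (n : ℕ) :
    ((cyclotomic (p ^ (n + 1)) ℤ).comp (X + 1)).Monic := by
  rw [show (X + 1 : ℤ[X]) = X + C 1 by simp]
  refine (cyclotomic.monic _ ℤ).comp (monic_X_add_C 1) fun h => ?_
  rw [natDegree_X_add_C] at h
  exact zero_ne_one h.symm

/-- The degree of `Φ_{p^{n+1}}(X + 1)` is `φ(p^{n+1}) = pⁿ(p-1)`. [folklore] -/
private theorem natDegree_cyclotomic_prime_pow_comp_X_add_one (n : ℕ) :
    ((cyclotomic (p ^ (n + 1)) ℤ).comp (X + 1)).natDegree = p ^ n * (p - 1) := by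
  rw [natDegree_comp, show (X + 1 : ℤ[X]) = X + C 1 by simp, natDegree_X_add_C, mul_one,
    natDegree_cyclotomic, Nat.totient_prime_pow hp.out n.succ_pos]
  simp

/-- `0 < pⁿ(p-1)` for a prime `p`. [folklore] -/
private theorem pos_pow_mul_pred (n : ℕ) : 0 < p ^ n * (p - 1) :=
  Nat.mul_pos (pow_pos hp.out.pos n) (by have := hp.out.two_le; omega)

/-- **`Φ_{p^{n+1}}(X+1)` is Eisenstein at the maximal ideal of `ℤ_p`** (Mathlib's
`cyclotomic_prime_pow_comp_X_add_one_isEisensteinAt` over `ℤ`, transported; the constant coefficient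
`Φ_{p^{n+1}}(1) = p` is not in `(p²)`) — the Eisenstein step of Serre's proof that `ℚ_p(ζ_{p^{n+1}})/ℚ_p` is totally
ramified of degree `φ(p^{n+1})`. (abc-iut-w5-d125's `cyclotomic_sq_comp_X_add_one_isEisensteinAt_padicInt` is `n = 1`.)
[cite: SerreLocalFields1979, IV §4 Prop 17] -/
theorem cyclotomic_prime_pow_comp_X_add_one_isEisensteinAt_padicInt (n : ℕ) :
    (((cyclotomic (p ^ (n + 1)) ℤ).comp (X + 1)).map (Int.castRingHom ℤ_[p])).IsEisensteinAt
      (IsLocalRing.maximalIdeal ℤ_[p]) := by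
  have hE : ((cyclotomic (p ^ (n + 1)) ℤ).comp (X + 1)).IsEisensteinAt (Submodule.span ℤ {(p : ℤ)}) :=
    cyclotomic_prime_pow_comp_X_add_one_isEisensteinAt p n
  have hmonic := (monic_cyclotomic_prime_pow_comp_X_add_one p n).map (Int.castRingHom ℤ_[p])
  refine hmonic.isEisensteinAt_of_mem_of_notMem (IsLocalRing.maximalIdeal.isMaximal ℤ_[p]).ne_top ?_ ?_
  · intro m hm
    have hw := (hE.isWeaklyEisensteinAt.map (Int.castRingHom ℤ_[p])).mem hm
    have hmap : Ideal.map (Int.castRingHom ℤ_[p]) (Submodule.span ℤ {(p : ℤ)}) =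
        Ideal.span {(p : ℤ_[p])} := by
      rw [Ideal.submodule_span_eq, Ideal.map_span, Set.image_singleton, map_natCast]
    rw [PadicInt.maximalIdeal_eq_span_p, ← hmap]
    exact hw
  · rw [coeff_map, coeff_zero_eq_eval_zero, eval_comp, eval_add, eval_X, eval_one, zero_add,
      eval_one_cyclotomic_prime_pow, map_natCast, PadicInt.maximalIdeal_eq_span_p,
      Ideal.span_singleton_pow, Ideal.mem_span_singleton]
    rintro ⟨c, hc⟩
    have hp0 : (p : ℤ_[p]) ≠ 0 := by exact_mod_cast hp.out.ne_zero
    have h1 : (p : ℤ_[p]) * 1 = (p : ℤ_[p]) * (p * c) := by rw [mul_one, ← mul_assoc, ← sq]; exact hc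
    have h2 : (1 : ℤ_[p]) = p * c := mul_left_cancel₀ hp0 h1
    exact (PadicInt.irreducible_p (p := p)).not_isUnit (isUnit_iff_exists_inv.2 ⟨c, h2.symm⟩)

/-- `Φ_{p^{n+1}}(X+1)` is irreducible over `ℤ_p` (Eisenstein criterion). [cite: SerreLocalFields1979, IV §4 Prop 17] -/
theorem irreducible_cyclotomic_prime_pow_comp_padicInt (n : ℕ) :
    Irreducible (((cyclotomic (p ^ (n + 1)) ℤ).comp (X + 1)).map (Int.castRingHom ℤ_[p])) := by
  have hmonic := (monic_cyclotomic_prime_pow_comp_X_add_one p n).map (Int.castRingHom ℤ_[p])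
  refine (cyclotomic_prime_pow_comp_X_add_one_isEisensteinAt_padicInt p n).irreducible
    (IsLocalRing.maximalIdeal.isMaximal ℤ_[p]).isPrime hmonic.isPrimitive ?_
  rw [(monic_cyclotomic_prime_pow_comp_X_add_one p n).natDegree_map,
    natDegree_cyclotomic_prime_pow_comp_X_add_one]
  exact pos_pow_mul_pred p n

/-- The base change to `ℚ_p` of `Φ_{p^{n+1}}(X+1) ∈ ℤ_p[X]` is `Φ_{p^{n+1}}(X+1) ∈ ℚ_p[X]`. [folklore] -/
private theorem map_cyclotomic_prime_pow_comp_eq (n : ℕ) :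
    (((cyclotomic (p ^ (n + 1)) ℤ).comp (X + 1)).map (Int.castRingHom ℤ_[p])).map (algebraMap ℤ_[p] ℚ_[p]) =
      (cyclotomic (p ^ (n + 1)) ℚ_[p]).comp (X + 1) := by
  rw [Polynomial.map_map, map_comp, Polynomial.map_add, map_X, Polynomial.map_one]
  congr 1
  have : (algebraMap ℤ_[p] ℚ_[p]).comp (Int.castRingHom ℤ_[p]) = Int.castRingHom ℚ_[p] :=
    RingHom.ext_int _ _
  rw [this, map_cyclotomic_int]

/-- **`Φ_{p^{n+1}}(X+1)` is irreducible over `ℚ_p`** (Gauss's lemma over the integrally closed `ℤ_p`).  (The same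
statement is proved independently in the BSD summit tree as
`Summit.BirchSwinnertonDyer.Rank1Residual.Iwasawa.irreducible_cyclotomic_comp_X_add_one`, which `Literature/` cannot
import.) [cite: SerreLocalFields1979, IV §4 Prop 17] -/
theorem irreducible_cyclotomic_prime_pow_comp_padic (n : ℕ) :
    Irreducible ((cyclotomic (p ^ (n + 1)) ℚ_[p]).comp (X + 1)) := by
  rw [← map_cyclotomic_prime_pow_comp_eq]
  exact (((monic_cyclotomic_prime_pow_comp_X_add_one p n).map
    (Int.castRingHom ℤ_[p])).irreducible_iff_irreducible_map_fraction_map (K := ℚ_[p])).1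
    (irreducible_cyclotomic_prime_pow_comp_padicInt p n)

/-- **`Φ_{pᵏ}` is irreducible over `ℚ_p` for every `k ≥ 1`** — equivalently `[ℚ_p(ζ_{pᵏ}) : ℚ_p] = φ(pᵏ)`
(undo the translate `X ↦ X + 1`, a ring automorphism of `ℚ_p[X]`). [cite: SerreLocalFields1979, IV §4 Prop 17] -/
theorem irreducible_cyclotomic_prime_pow_padic {k : ℕ} (hk : 0 < k) : Irreducible (cyclotomic (p ^ k) ℚ_[p]) := by
  obtain ⟨n, rfl⟩ := Nat.exists_eq_succ_of_ne_zero hk.ne'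
  have h := irreducible_cyclotomic_prime_pow_comp_padic p n
  rw [show (X + 1 : ℚ_[p][X]) = X + C 1 by rw [map_one], comp_eq_aeval, ← algEquivAevalXAddC_apply] at h
  exact (MulEquiv.irreducible_iff (algEquivAevalXAddC (1 : ℚ_[p]))).mp h

/-! ### `G_{ℚ_p}` realises every unit exponent on `μ_{pᵏ}(ℚ̄_p)` -/

/-- **For every unit `a ∈ (ℤ/pᵏℤ)^×` some `σ ∈ G_{ℚ_p}` acts on ALL `pᵏ`-th roots of unity of `ℚ̄_p` by `ζ ↦ ζ ^ a`**
(`Gal(ℚ_p(μ_{pᵏ})/ℚ_p) ≃ (ℤ/pᵏℤ)^×` by the irreducibility of `Φ_{pᵏ}`, and extension of automorphisms to `ℚ̄_p`; the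
tree's `RootOfUnityAction.exists_smul_eq_pow_and_smul_eq_self`). [cite: Washington1997, Thm 2.5] -/
theorem exists_algEquiv_apply_eq_pow_of_prime_pow {k : ℕ} (hk : 0 < k) (a : (ZMod (p ^ k))ˣ) :
    ∃ σ : GQp p, ∀ ζ : PadicAlgCl p, ζ ^ (p ^ k) = 1 → σ ζ = ζ ^ (a : ZMod (p ^ k)).val := by
  haveI : NeZero (p ^ k) := ⟨pow_ne_zero k hp.out.ne_zero⟩
  have hirr : Irreducible (cyclotomic (p ^ k * 1) ℚ_[p]) := by
    rw [mul_one]; exact irreducible_cyclotomic_prime_pow_padic p hk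
  obtain ⟨σ, hσ, -⟩ :=
    Literature.NumberTheory.GaloisRepresentations.RootOfUnityAction.exists_smul_eq_pow_and_smul_eq_self
      (K := ℚ_[p]) (A := p ^ k) (B := 1) (Nat.coprime_one_right _) hirr a
  refine ⟨Field.absoluteGaloisGroup.toAlgEquiv ℚ_[p] σ, fun ζ hζ => ?_⟩
  rw [← Field.absoluteGaloisGroup.smul_def]
  exact hσ ζ hζ

/-- `galMuN` form: for every unit `a ∈ (ℤ/pᵏℤ)^×` some `σ ∈ G_{ℚ_p}` acts on `μ_{pᵏ}(ℚ̄_p)` as the `a`-th power map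
(`galMuN p pᵏ σ = (· ^ a)`). [cite: MochizukiEtTh2009, §1 p.13] -/
theorem exists_galMuN_eq_pow_of_prime_pow {k : ℕ} (hk : 0 < k) (a : (ZMod (p ^ k))ˣ) :
    ∃ σ : GQp p, ∀ u : MuN p ⟨p ^ k, pow_pos hp.out.pos k⟩,
      galMuN p ⟨p ^ k, pow_pos hp.out.pos k⟩ σ u = u ^ (a : ZMod (p ^ k)).val := by
  obtain ⟨σ, hσ⟩ := exists_algEquiv_apply_eq_pow_of_prime_pow p hk a
  refine ⟨σ, fun u => ?_⟩
  have huN : (((u : (PadicAlgCl p)ˣ)) : PadicAlgCl p) ^ (p ^ k) = 1 := by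
    have h : (u : (PadicAlgCl p)ˣ) ^ (p ^ k) = 1 := (mem_rootsOfUnity _ _).mp u.2
    rw [← Units.val_pow_eq_pow_val, h, Units.val_one]
  apply Subtype.ext
  apply Units.ext
  rw [galMuN_apply_coe, hσ _ huN, SubgroupClass.coe_pow, Units.val_pow_eq_pow_val]

/-! ### The χ-form: `χ_{pᵏ} = levelChar (pᵏ) ∘ χ : G_{ℚ_p} → ℤ/pᵏℤ` has image `(ℤ/pᵏℤ)^×` -/

namespace SettingModel

/-- **Every unit `a ∈ (ℤ/pᵏℤ)^×` is a value of the mod-`pᵏ` cyclotomic character on `G_{ℚ_p}`**: some `σ` has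
`χ_{pᵏ}(σ) = a` (`σ` raising a primitive `pᵏ`-th root of unity to the `a`-th power; F3's
`levelChar_chi_eq_of_isPrimitiveRoot`). [cite: SerreLocalFields1979, IV §4 Prop 17] -/
theorem exists_levelChar_chi_eq {k : ℕ} (hk : 0 < k) (a : (ZMod (p ^ k))ˣ) :
    ∃ σ : GQp p, ZHatLevel.levelChar ⟨p ^ k, pow_pos hp.out.pos k⟩ (chi p σ) = (a : ZMod (p ^ k)) := by
  obtain ⟨σ, hσ⟩ := exists_algEquiv_apply_eq_pow_of_prime_pow p hk a
  haveI : NeZero ((p ^ k : ℕ) : PadicAlgCl p) := ⟨by exact_mod_cast pow_ne_zero k hp.out.ne_zero⟩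
  obtain ⟨ζ, hζ⟩ := HasEnoughRootsOfUnity.prim (M := PadicAlgCl p) (n := p ^ k)
  refine ⟨σ, ?_⟩
  have h := levelChar_chi_eq_of_isPrimitiveRoot p σ ⟨p ^ k, pow_pos hp.out.pos k⟩ (ξ := ζ)
    (by rw [PNat.mk_coe]; exact hζ) (hσ ζ hζ.pow_eq_one)
  rw [h]
  exact ZMod.natCast_zmod_val _

/-- `χ_N(σ)` is always a unit of `ℤ/Nℤ` (`χ(σ) ∈ Aut(Ẑ)` is invertible). [cite: RibesZalesskii2010, Thm 2.7.1] -/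
theorem isUnit_levelChar_chi (N : ℕ+) (σ : GQp p) : IsUnit (ZHatLevel.levelChar N (chi p σ)) :=
  (Group.isUnit (chi p σ)).map (ZHatLevel.levelChar N)

/-- **The image of `χ_{pᵏ} : G_{ℚ_p} → ℤ/pᵏℤ` is EXACTLY the unit group `(ℤ/pᵏℤ)^×`**
(`Gal(ℚ_p(ζ_{pᵏ})/ℚ_p) = (ℤ/pᵏℤ)^×`). [cite: SerreLocalFields1979, IV §4 Prop 17] -/
theorem range_levelChar_chi_prime_pow {k : ℕ} (hk : 0 < k) :
    Set.range (fun σ : GQp p => ZHatLevel.levelChar ⟨p ^ k, pow_pos hp.out.pos k⟩ (chi p σ)) =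
      {c : ZMod ((⟨p ^ k, pow_pos hp.out.pos k⟩ : ℕ+) : ℕ) | IsUnit c} :=
  Set.ext fun c =>
    ⟨fun ⟨σ, hσ⟩ => hσ ▸ isUnit_levelChar_chi p ⟨p ^ k, pow_pos hp.out.pos k⟩ σ,
     fun hc => by
       obtain ⟨σ, hσ⟩ := exists_levelChar_chi_eq p hk (IsUnit.unit hc)
       exact ⟨σ, hσ.trans (IsUnit.unit_spec hc)⟩⟩

/-- Surjectivity packaged on units: **`σ ↦ χ_{pᵏ}(σ) ∈ (ℤ/pᵏℤ)^×` is SURJECTIVE on `G_{ℚ_p}`**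
(`Gal(ℚ_p(ζ_{pᵏ})/ℚ_p) ↠ (ℤ/pᵏℤ)^×`; with F3's `isOpen_setOf_levelChar_chi_eq` every fibre is a non-empty open set).
[cite: SerreLocalFields1979, IV §4 Prop 17] -/
theorem surjective_levelChar_chi_units {k : ℕ} (hk : 0 < k) :
    Function.Surjective (fun σ : GQp p => (isUnit_levelChar_chi p ⟨p ^ k, pow_pos hp.out.pos k⟩ σ).unit) := by
  intro a
  obtain ⟨σ, hσ⟩ := exists_levelChar_chi_eq p hk a
  exact ⟨σ, Units.ext (by rw [IsUnit.unit_spec]; exact hσ)⟩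

end SettingModel

end Literature.AnabelianGeometry.EtaleTheta

end
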